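import Mathlib
import HarnessLib
import Summits.Ventures.LatticeQCDFlow.Exactness.SphereGeodesicKick
import Summits.Ventures.LatticeQCDFlow.Exactness.SphereLOFlowAction
import Summits.Ventures.LatticeQCDFlow.Exactness.SphereSiteLaplacianCalculus
import Summits.Ventures.LatticeQCDFlow.Exactness.SphereNLOFlowTerms

/-!
# The next-to-leading-order flow action of the lattice CP(N−1)/O(N) model in closed form: `S̃⁽¹⁾ = −(2κ²/(d−1)) [A/(2d−1) − B/(4d−2) − C/(4d)]` solves Lüscher's order-`t¹` equation

HONEST FRAMING: exact (Metropolis-corrected) sampling algorithms for lattice gauge theory;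
figures of merit are autocorrelation/cost numbers at stated couplings and volumes; no
continuum-physics claim.

Venture `LatticeQCDFlow` (cell pub-lqcd), topic `Exactness`; FANOUT row 7 (`s0-cpn-null`: the
S0-D1 rung — 2D CP⁹, Lüscher's LO trivializing map inside HMC, Engel–Schaefer 2011).  NEW WORK of
the cell: Engel–Schaefer implement the LEADING order only ("the leading order term can be
constructed easily"); this file constructs and certifies the NEXT order for the same action class,
over the tree's `SphereLOFlowAction.lean` (`esAction`, `localField`, `loFlowAction`, `siteGrad`,
`siteLaplacian`, `siteGrad_esAction`, `loGenerator_eq`), `SphereSiteLaplacianCalculus.lean`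
(linearity of `∂̃²`) and `SphereNLOFlowTerms.lean` (the three terms and `Σ_k ∂̃²_k` on each);
nothing is cited as a fact.  Printed counterparts, NAMED ONLY: M. Lüscher, Commun. Math. Phys. 293
(2010) 899, §4.2 eq. (4.5) (`𝓛_t S̃_t = S + Ċ_t`, `𝓛_t = −Δ + t ∂S·∂`) and §4.3 eqs. (4.12)–(4.15)
(its expansion in `t`: `−ΔS̃⁽⁰⁾ = S + Ċ⁽⁰⁾`, `−ΔS̃⁽¹⁾ + ∂S·∂S̃⁽⁰⁾ = Ċ⁽¹⁾`, …; for the Wilson action the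
orders are polynomials in Wilson loops, §4.4); Engel–Schaefer, Comput. Phys. Commun. 182 (2011)
2107, §3 eqs. (14)–(16) (the leading order for CP(N−1)).

## Content (`E` finite-dimensional, `d = dim E ≥ 2`; couplings `U` with no self-coupling and
adjoint pairs; configurations on the product of unit spheres; `p_n = tangentKick (J_n x) (x n)`)

* `stapleSum A = Σ_n Σ_{m≠m'} ⟪U_{nm}x_m, U_{nm'}x_{m'}⟫`, `crossSum B = Σ_n Σ_{m≠m'} ⟪U_{nm}x_m,
  x_n⟫⟪U_{nm'}x_{m'}, x_n⟫`, `squareSum C = Σ_n Σ_m ⟪U_{nm}x_m, x_n⟫²`, `normSum D = Σ_n Σ_m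
  ‖U_{nm}x_m‖²` (configuration-independent for isometric-or-zero couplings: `normSum_eq`);
  **`sum_norm_tangentKick_sq`**: `Σ_n ‖p_n‖² = D + A − B − C`.
* `sum_siteLaplacian_stapleSum/_crossSum/_squareSum`: `Σ_k ∂̃²_k A = −2(d−1)A`,
  `Σ_k ∂̃²_k B = 2A − (4d−2)B`, `Σ_k ∂̃²_k C = 4D − 4dC`.
* `nloPotential W = A/(2d−1) − B/(4d−2) − C/(4d)`; **`neg_sum_siteLaplacian_nloPotential`**:
  `−Σ_k ∂̃²_k W = Σ_n ‖p_n‖² − (1 − 1/d) D`.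
* `nloFlowAction S̃⁽¹⁾ = −(2κ²/(d−1)) W`, i.e.
  **`S̃⁽¹⁾ = −(2κ²/((d−1)(2d−1))) A + (κ²/((d−1)(2d−1))) B + (κ²/(2d(d−1))) C`**;
  `sum_inner_siteGrad_esAction_loFlowAction`: `Σ_k ⟪∂̃_k S, ∂̃_k S̃⁽⁰⁾⟫ = (2κ²/(d−1)) Σ_k ‖p_k‖²`;
  **`nlo_equation`**: `−Σ_k ∂̃²_k S̃⁽¹⁾ + Σ_k ⟪∂̃_k S, ∂̃_k S̃⁽⁰⁾⟫ = (2κ²/d) D` — LÜSCHER'S ORDER-`t¹`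
  EQUATION (4.13)/(4.5) for the CP(N−1)/O(N) action, with the constant `Ċ⁽¹⁾ = (2κ²/d) D`
  explicit.  For CP(N−1) (`d = 2N`, `κ = Nβ`, nearest neighbours with unit-modulus links,
  `D = 2·#links`): `S̃⁽¹⁾ = −(2N²β²/((2N−1)(4N−1))) A + (N²β²/((2N−1)(4N−1))) B + (Nβ²/(4(2N−1))) C`.

NOT CLAIMED: orders `k ≥ 2`; the flow `ẋ = −∂̃(S̃⁽⁰⁾ + t S̃⁽¹⁾)`, its Euler step or Jacobian (the
generator `−∂̃_n S̃⁽¹⁾` couples next-nearest neighbours and is not typed here); any statement that the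
NLO map improves sampling; anything quantitative.
-/

noncomputable section

namespace Summit.Ventures.LatticeQCDFlow.Exactness

open NormedSpace Filter
open scoped RealInnerProductSpace Gradient

variable {E : Type*} [NormedAddCommGroup E] [InnerProductSpace ℝ E]
variable {Λ : Type*} [Fintype Λ] [DecidableEq Λ]

/-! ## §1 The four lattice sums and the decomposition of `Σ_n ‖p_n‖²` -/

section Sums

/-- `A = Σ_n Σ_{m ≠ m'} ⟪U_{nm} x_m, U_{nm'} x_{m'}⟫` (staples). -/
def stapleSum (U : Λ → Λ → (E →L[ℝ] E)) (x : Λ → E) : ℝ := ∑ n, ∑ m, ∑ m', stapleTerm U n m m' x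

/-- `B = Σ_n Σ_{m ≠ m'} ⟪U_{nm} x_m, x_n⟫⟪U_{nm'} x_{m'}, x_n⟫` (cross terms). -/
def crossSum (U : Λ → Λ → (E →L[ℝ] E)) (x : Λ → E) : ℝ := ∑ n, ∑ m, ∑ m', crossTerm U n m m' x

/-- `C = Σ_n Σ_m ⟪U_{nm} x_m, x_n⟫²` (squares). -/
def squareSum (U : Λ → Λ → (E →L[ℝ] E)) (x : Λ → E) : ℝ := ∑ n, ∑ m, squareTerm U n m x

/-- `D = Σ_n Σ_m ‖U_{nm} x_m‖²` (for isometric-or-zero couplings on unit vectors: the number of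
ordered coupled pairs). -/
def normSum (U : Λ → Λ → (E →L[ℝ] E)) (x : Λ → E) : ℝ := ∑ n, ∑ m, ‖U n m (x m)‖ ^ 2

variable (U : Λ → Λ → (E →L[ℝ] E))

/-- `‖J_n‖² = Σ_m ‖U_{nm}x_m‖² + Σ_{m≠m'} ⟪U_{nm}x_m, U_{nm'}x_{m'}⟫`. -/
theorem norm_localField_sq (n : Λ) (x : Λ → E) :
    ‖localField U n x‖ ^ 2 = ∑ m, ‖U n m (x m)‖ ^ 2 + ∑ m, ∑ m', stapleTerm U n m m' x := by
  rw [← real_inner_self_eq_norm_sq, localField, sum_inner]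
  simp_rw [inner_sum]
  rw [← Finset.sum_add_distrib]
  refine Finset.sum_congr rfl fun m _ => ?_
  have h : ∀ m', ⟪U n m (x m), U n m' (x m')⟫ =
      (if m = m' then ⟪U n m (x m), U n m' (x m')⟫ else 0) + stapleTerm U n m m' x := fun m' => by
    unfold stapleTerm; split_ifs <;> simp
  rw [Finset.sum_congr rfl fun m' _ => h m', Finset.sum_add_distrib, Finset.sum_ite_eq]
  simp

/-- `⟪J_n, x_n⟫² = Σ_m ⟪U_{nm}x_m, x_n⟫² + Σ_{m≠m'} ⟪U_{nm}x_m, x_n⟫⟪U_{nm'}x_{m'}, x_n⟫`. -/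
theorem inner_localField_sq (n : Λ) (x : Λ → E) :
    ⟪localField U n x, x n⟫ ^ 2 = ∑ m, squareTerm U n m x + ∑ m, ∑ m', crossTerm U n m m' x := by
  rw [localField, sum_inner, sq, Finset.sum_mul_sum, ← Finset.sum_add_distrib]
  refine Finset.sum_congr rfl fun m _ => ?_
  have h : ∀ m', ⟪U n m (x m), x n⟫ * ⟪U n m' (x m'), x n⟫ =
      (if m = m' then ⟪U n m (x m), x n⟫ * ⟪U n m' (x m'), x n⟫ else 0) + crossTerm U n m m' x :=
    fun m' => by unfold crossTerm; split_ifs <;> simp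
  rw [Finset.sum_congr rfl fun m' _ => h m', Finset.sum_add_distrib, Finset.sum_ite_eq]
  simp [squareTerm]

/-- **`Σ_n ‖p_n‖² = D + A − B − C`** on the product of unit spheres. -/
theorem sum_norm_tangentKick_sq {x : Λ → E} (hx : ∀ n, ‖x n‖ = 1) :
    ∑ n, ‖tangentKick (localField U n x) (x n)‖ ^ 2 =
      normSum U x + stapleSum U x - crossSum U x - squareSum U x := by
  unfold normSum stapleSum crossSum squareSum
  rw [← Finset.sum_add_distrib, ← Finset.sum_sub_distrib, ← Finset.sum_sub_distrib]
  refine Finset.sum_congr rfl fun n _ => ?_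
  rw [norm_tangentKick_sq _ (hx n), norm_localField_sq, inner_localField_sq]
  ring

omit [DecidableEq Λ] in
/-- For isometric-or-zero couplings, `D` does not depend on the (unit) configuration. -/
theorem normSum_eq (hIso : ∀ n m, U n m = 0 ∨ ∀ v, ‖U n m v‖ = ‖v‖) {x x' : Λ → E}
    (hx : ∀ n, ‖x n‖ = 1) (hx' : ∀ n, ‖x' n‖ = 1) : normSum U x = normSum U x' := by
  unfold normSum
  refine Finset.sum_congr rfl fun n _ => Finset.sum_congr rfl fun m _ => ?_
  rcases hIso n m with h | h
  · simp [h]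
  · rw [h, h, hx, hx']

end Sums

/-! ## §2 The lattice Laplace–Beltrami operator on the three sums -/

section Laplacians

variable [FiniteDimensional ℝ E] {U : Λ → Λ → (E →L[ℝ] E)}

/-- Pushing `Σ_k ∂̃²_k` through a triple sum of smooth terms. -/
theorem sum_siteLaplacian_sum₃ (T : Λ → Λ → Λ → (Λ → E) → ℝ) (hT : ∀ n m m', ContDiff ℝ 2 (T n m m'))
    {x : Λ → E} (hx0 : ∀ k, x k ≠ 0) :
    ∑ k, siteLaplacian k (fun x' => ∑ n, ∑ m, ∑ m', T n m m' x') x =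
      ∑ n, ∑ m, ∑ m', ∑ k, siteLaplacian k (T n m m') x := by
  have h1 : ∀ k, siteLaplacian k (fun x' => ∑ n, ∑ m, ∑ m', T n m m' x') x =
      ∑ n, ∑ m, ∑ m', siteLaplacian k (T n m m') x := by
    intro k
    rw [siteLaplacian_finset_sum (G := fun n x' => ∑ m, ∑ m', T n m m' x') _ (hx0 k)
      (fun n _ => ContDiff.sum fun m _ => ContDiff.sum fun m' _ =>
        contDiff_comp_update (hT n m m') x k)]
    refine Finset.sum_congr rfl fun n _ => ?_
    rw [siteLaplacian_finset_sum (G := fun m x' => ∑ m', T n m m' x') _ (hx0 k)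
      (fun m _ => ContDiff.sum fun m' _ => contDiff_comp_update (hT n m m') x k)]
    refine Finset.sum_congr rfl fun m _ => ?_
    exact siteLaplacian_finset_sum _ (hx0 k) fun m' _ => contDiff_comp_update (hT n m m') x k
  simp_rw [h1]
  rw [Finset.sum_comm]
  refine Finset.sum_congr rfl fun n _ => ?_
  rw [Finset.sum_comm]
  refine Finset.sum_congr rfl fun m _ => ?_
  rw [Finset.sum_comm]

/-- Pushing `Σ_k ∂̃²_k` through a double sum of smooth terms. -/
theorem sum_siteLaplacian_sum₂ (T : Λ → Λ → (Λ → E) → ℝ) (hT : ∀ n m, ContDiff ℝ 2 (T n m))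
    {x : Λ → E} (hx0 : ∀ k, x k ≠ 0) :
    ∑ k, siteLaplacian k (fun x' => ∑ n, ∑ m, T n m x') x =
      ∑ n, ∑ m, ∑ k, siteLaplacian k (T n m) x := by
  have h1 : ∀ k, siteLaplacian k (fun x' => ∑ n, ∑ m, T n m x') x =
      ∑ n, ∑ m, siteLaplacian k (T n m) x := by
    intro k
    rw [siteLaplacian_finset_sum (G := fun n x' => ∑ m, T n m x') _ (hx0 k)
      (fun n _ => ContDiff.sum fun m _ => contDiff_comp_update (hT n m) x k)]
    refine Finset.sum_congr rfl fun n _ => ?_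
    exact siteLaplacian_finset_sum _ (hx0 k) fun m _ => contDiff_comp_update (hT n m) x k
  simp_rw [h1]
  rw [Finset.sum_comm]
  refine Finset.sum_congr rfl fun n _ => ?_
  rw [Finset.sum_comm]

/-- **`Σ_k ∂̃²_k A = −2(d−1) A`.** -/
theorem sum_siteLaplacian_stapleSum (hUadj : ∀ m n (v w : E), ⟪U m n v, w⟫ = ⟪v, U n m w⟫)
    {x : Λ → E} (hx : ∀ n, ‖x n‖ = 1) :
    ∑ k, siteLaplacian k (stapleSum U) x = -(2 * ((Module.finrank ℝ E : ℝ) - 1)) * stapleSum U x := by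
  have hx0 : ∀ k, x k ≠ 0 := fun k => ne_zero_of_norm_ne_zero (by rw [hx k]; exact one_ne_zero)
  unfold stapleSum
  rw [sum_siteLaplacian_sum₃ _ (fun n m m' => contDiff_stapleTerm U n m m') hx0]
  simp_rw [sum_siteLaplacian_stapleTerm hUadj _ _ _ hx]
  simp only [Finset.mul_sum]

/-- **`Σ_k ∂̃²_k B = 2A − (4d−2) B`.** -/
theorem sum_siteLaplacian_crossSum (hU0 : ∀ n, U n n = 0)
    (hUadj : ∀ m n (v w : E), ⟪U m n v, w⟫ = ⟪v, U n m w⟫) {x : Λ → E} (hx : ∀ n, ‖x n‖ = 1) :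
    ∑ k, siteLaplacian k (crossSum U) x =
      2 * stapleSum U x - (4 * (Module.finrank ℝ E : ℝ) - 2) * crossSum U x := by
  have hx0 : ∀ k, x k ≠ 0 := fun k => ne_zero_of_norm_ne_zero (by rw [hx k]; exact one_ne_zero)
  unfold crossSum stapleSum
  rw [sum_siteLaplacian_sum₃ _ (fun n m m' => contDiff_crossTerm U n m m') hx0]
  simp_rw [sum_siteLaplacian_crossTerm hU0 hUadj _ _ _ hx]
  simp only [Finset.sum_sub_distrib, Finset.mul_sum]

/-- **`Σ_k ∂̃²_k C = 4D − 4d C`.** -/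
theorem sum_siteLaplacian_squareSum (hU0 : ∀ n, U n n = 0)
    (hUadj : ∀ m n (v w : E), ⟪U m n v, w⟫ = ⟪v, U n m w⟫) {x : Λ → E} (hx : ∀ n, ‖x n‖ = 1) :
    ∑ k, siteLaplacian k (squareSum U) x =
      4 * normSum U x - 4 * (Module.finrank ℝ E : ℝ) * squareSum U x := by
  have hx0 : ∀ k, x k ≠ 0 := fun k => ne_zero_of_norm_ne_zero (by rw [hx k]; exact one_ne_zero)
  unfold squareSum normSum
  rw [sum_siteLaplacian_sum₂ _ (fun n m => contDiff_squareTerm U n m) hx0]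
  simp_rw [sum_siteLaplacian_squareTerm hU0 hUadj _ _ hx]
  have hswap : ∑ n, ∑ m, ‖U m n (x n)‖ ^ 2 = ∑ n, ∑ m, ‖U n m (x m)‖ ^ 2 := Finset.sum_comm
  simp only [Finset.sum_sub_distrib, Finset.sum_add_distrib, ← Finset.mul_sum]
  rw [hswap]
  ring

end Laplacians

/-! ## §3 The next-to-leading-order potential and Lüscher's order-`t¹` equation -/

section NLO

variable [FiniteDimensional ℝ E]

/-- **The solution of the order-`t¹` Poisson problem, up to the coupling prefactor**:
`W = A/(2d−1) − B/(4d−2) − C/(4d)` with `−Σ_k ∂̃²_k W = Σ_n ‖p_n‖² − (1 − 1/d) D`. -/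
def nloPotential (U : Λ → Λ → (E →L[ℝ] E)) (x : Λ → E) : ℝ :=
  (2 * (Module.finrank ℝ E : ℝ) - 1)⁻¹ * stapleSum U x -
    (2 * (2 * (Module.finrank ℝ E : ℝ) - 1))⁻¹ * crossSum U x -
      (4 * (Module.finrank ℝ E : ℝ))⁻¹ * squareSum U x

/-- **The next-to-leading-order flow action** `S̃⁽¹⁾ = −(2κ²/(d−1)) W`, i.e.
`S̃⁽¹⁾ = −(2κ²/((d−1)(2d−1))) A + (κ²/((d−1)(2d−1))) B + (κ²/(2d(d−1))) C`. -/
def nloFlowAction (κ : ℝ) (U : Λ → Λ → (E →L[ℝ] E)) (x : Λ → E) : ℝ :=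
  -(2 * κ ^ 2 / ((Module.finrank ℝ E : ℝ) - 1)) * nloPotential U x

variable {U : Λ → Λ → (E →L[ℝ] E)}

omit [FiniteDimensional ℝ E] in
/-- The sums are smooth on configuration space. -/
theorem contDiff_sums (U : Λ → Λ → (E →L[ℝ] E)) :
    ContDiff ℝ 2 (stapleSum U) ∧ ContDiff ℝ 2 (crossSum U) ∧ ContDiff ℝ 2 (squareSum U) := by
  refine ⟨?_, ?_, ?_⟩
  · unfold stapleSum
    exact ContDiff.sum fun n _ => ContDiff.sum fun m _ => ContDiff.sum fun m' _ =>
      contDiff_stapleTerm U n m m'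
  · unfold crossSum
    exact ContDiff.sum fun n _ => ContDiff.sum fun m _ => ContDiff.sum fun m' _ =>
      contDiff_crossTerm U n m m'
  · unfold squareSum
    exact ContDiff.sum fun n _ => ContDiff.sum fun m _ => contDiff_squareTerm U n m

/-- `Σ_k ∂̃²_k W` in terms of the sums. -/
theorem sum_siteLaplacian_nloPotential (hU0 : ∀ n, U n n = 0)
    (hUadj : ∀ m n (v w : E), ⟪U m n v, w⟫ = ⟪v, U n m w⟫) (hd : 2 ≤ Module.finrank ℝ E)
    {x : Λ → E} (hx : ∀ n, ‖x n‖ = 1) :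
    ∑ k, siteLaplacian k (nloPotential U) x =
      -(stapleSum U x - crossSum U x - squareSum U x) -
        (Module.finrank ℝ E : ℝ)⁻¹ * normSum U x := by
  have hd' : (2 : ℝ) ≤ Module.finrank ℝ E := by exact_mod_cast hd
  have h1 : (2 * (Module.finrank ℝ E : ℝ) - 1) ≠ 0 := by intro h; linarith
  have h2 : (4 * (Module.finrank ℝ E : ℝ) - 2) ≠ 0 := by intro h; linarith
  have h3 : (4 * (Module.finrank ℝ E : ℝ)) ≠ 0 := by intro h; linarith
  have h4 : (Module.finrank ℝ E : ℝ) ≠ 0 := by intro h; linarith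
  obtain ⟨hA, hB, hC⟩ := contDiff_sums U
  have hx0 : ∀ k, x k ≠ 0 := fun k => ne_zero_of_norm_ne_zero (by rw [hx k]; exact one_ne_zero)
  -- linearity, site by site
  have hk : ∀ k, siteLaplacian k (nloPotential U) x =
      (2 * (Module.finrank ℝ E : ℝ) - 1)⁻¹ * siteLaplacian k (stapleSum U) x -
        (2 * (2 * (Module.finrank ℝ E : ℝ) - 1))⁻¹ * siteLaplacian k (crossSum U) x -
          (4 * (Module.finrank ℝ E : ℝ))⁻¹ * siteLaplacian k (squareSum U) x := by
    intro k
    have hA' := contDiff_comp_update hA x k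
    have hB' := contDiff_comp_update hB x k
    have hC' := contDiff_comp_update hC x k
    unfold nloPotential
    rw [siteLaplacian_sub (G := fun x' => (2 * (Module.finrank ℝ E : ℝ) - 1)⁻¹ * stapleSum U x' -
          (2 * (2 * (Module.finrank ℝ E : ℝ) - 1))⁻¹ * crossSum U x')
        (H := fun x' => (4 * (Module.finrank ℝ E : ℝ))⁻¹ * squareSum U x') (hx0 k)
        ((contDiff_const.mul hA').sub (contDiff_const.mul hB')) (contDiff_const.mul hC'),
      siteLaplacian_sub (G := fun x' => (2 * (Module.finrank ℝ E : ℝ) - 1)⁻¹ * stapleSum U x')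
        (H := fun x' => (2 * (2 * (Module.finrank ℝ E : ℝ) - 1))⁻¹ * crossSum U x') (hx0 k)
        (contDiff_const.mul hA') (contDiff_const.mul hB'),
      siteLaplacian_const_mul (hx0 k) hA', siteLaplacian_const_mul (hx0 k) hB',
      siteLaplacian_const_mul (hx0 k) hC']
  simp_rw [hk]
  rw [Finset.sum_sub_distrib, Finset.sum_sub_distrib, ← Finset.mul_sum, ← Finset.mul_sum,
    ← Finset.mul_sum, sum_siteLaplacian_stapleSum hUadj hx, sum_siteLaplacian_crossSum hU0 hUadj hx,
    sum_siteLaplacian_squareSum hU0 hUadj hx]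
  have e1 : (2 * (Module.finrank ℝ E : ℝ) - 1)⁻¹ *
      (-(2 * ((Module.finrank ℝ E : ℝ) - 1)) * stapleSum U x) -
      (2 * (2 * (Module.finrank ℝ E : ℝ) - 1))⁻¹ * (2 * stapleSum U x) = -stapleSum U x := by
    rw [← sub_eq_zero]
    field_simp
    ring
  have e2 : (2 * (2 * (Module.finrank ℝ E : ℝ) - 1))⁻¹ *
      ((4 * (Module.finrank ℝ E : ℝ) - 2) * crossSum U x) = crossSum U x := by
    rw [show (4 * (Module.finrank ℝ E : ℝ) - 2) = 2 * (2 * (Module.finrank ℝ E : ℝ) - 1) by ring,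
      inv_mul_cancel_left₀ (mul_ne_zero two_ne_zero h1)]
  have e3 : (4 * (Module.finrank ℝ E : ℝ))⁻¹ * (4 * normSum U x) =
      (Module.finrank ℝ E : ℝ)⁻¹ * normSum U x := by
    rw [mul_inv, mul_mul_mul_comm, inv_mul_cancel₀ (by norm_num : (4 : ℝ) ≠ 0), one_mul]
  have e4 : (4 * (Module.finrank ℝ E : ℝ))⁻¹ * (4 * (Module.finrank ℝ E : ℝ) * squareSum U x) =
      squareSum U x := inv_mul_cancel_left₀ h3 _
  calc (2 * (Module.finrank ℝ E : ℝ) - 1)⁻¹ * (-(2 * ((Module.finrank ℝ E : ℝ) - 1)) * stapleSum U x) -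
        (2 * (2 * (Module.finrank ℝ E : ℝ) - 1))⁻¹ *
          (2 * stapleSum U x - (4 * (Module.finrank ℝ E : ℝ) - 2) * crossSum U x) -
        (4 * (Module.finrank ℝ E : ℝ))⁻¹ *
          (4 * normSum U x - 4 * (Module.finrank ℝ E : ℝ) * squareSum U x)
      = ((2 * (Module.finrank ℝ E : ℝ) - 1)⁻¹ *
            (-(2 * ((Module.finrank ℝ E : ℝ) - 1)) * stapleSum U x) -
          (2 * (2 * (Module.finrank ℝ E : ℝ) - 1))⁻¹ * (2 * stapleSum U x)) +
        (2 * (2 * (Module.finrank ℝ E : ℝ) - 1))⁻¹ *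
          ((4 * (Module.finrank ℝ E : ℝ) - 2) * crossSum U x) -
        (4 * (Module.finrank ℝ E : ℝ))⁻¹ * (4 * normSum U x) +
        (4 * (Module.finrank ℝ E : ℝ))⁻¹ * (4 * (Module.finrank ℝ E : ℝ) * squareSum U x) := by ring
    _ = -(stapleSum U x - crossSum U x - squareSum U x) -
        (Module.finrank ℝ E : ℝ)⁻¹ * normSum U x := by rw [e1, e2, e3, e4]; ring

/-- **`−Σ_k ∂̃²_k W = Σ_n ‖p_n‖² − (1 − 1/d) D`.** -/
theorem neg_sum_siteLaplacian_nloPotential (hU0 : ∀ n, U n n = 0)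
    (hUadj : ∀ m n (v w : E), ⟪U m n v, w⟫ = ⟪v, U n m w⟫) (hd : 2 ≤ Module.finrank ℝ E)
    {x : Λ → E} (hx : ∀ n, ‖x n‖ = 1) :
    -∑ k, siteLaplacian k (nloPotential U) x =
      ∑ n, ‖tangentKick (localField U n x) (x n)‖ ^ 2 -
        (1 - (Module.finrank ℝ E : ℝ)⁻¹) * normSum U x := by
  rw [sum_siteLaplacian_nloPotential hU0 hUadj hd hx, sum_norm_tangentKick_sq U hx]
  ring

/-- **The source of the order-`t¹` equation**: `Σ_k ⟪∂̃_k S, ∂̃_k S̃⁽⁰⁾⟫ = (2κ²/(d−1)) Σ_k ‖p_k‖²`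
(`∂̃_k S = −2κ p_k`, `∂̃_k S̃⁽⁰⁾ = −(κ/(d−1)) p_k`). -/
theorem sum_inner_siteGrad_esAction_loFlowAction (hU0 : ∀ n, U n n = 0)
    (hUadj : ∀ m n (v w : E), ⟪U m n v, w⟫ = ⟪v, U n m w⟫) (hd : 2 ≤ Module.finrank ℝ E)
    (κ S₀ : ℝ) {x : Λ → E} (hx : ∀ n, ‖x n‖ = 1) :
    ∑ k, ⟪siteGrad k (esAction κ S₀ U) x, siteGrad k (loFlowAction κ S₀ U) x⟫ =
      (2 * κ ^ 2 / ((Module.finrank ℝ E : ℝ) - 1)) *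
        ∑ k, ‖tangentKick (localField U k x) (x k)‖ ^ 2 := by
  rw [Finset.mul_sum]
  refine Finset.sum_congr rfl fun k _ => ?_
  have h1 := siteGrad_esAction hU0 hUadj κ S₀ (hx k) (n := k)
  have h2 : siteGrad k (loFlowAction κ S₀ U) x = -loGenerator κ S₀ U k x := by
    rw [loGenerator, neg_neg]
  rw [h1, h2, loGenerator_eq hU0 hUadj hd κ S₀ (hx k), inner_neg_right, real_inner_smul_left,
    real_inner_smul_right, real_inner_self_eq_norm_sq]
  ring

/-- **Lüscher's order-`t¹` equation for the CP(N−1)/O(N) action, solved in closed form.**  With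
`S̃⁽⁰⁾ = S/(2(d−1))` (`SphereLOFlowAction.loFlowAction`) and
`S̃⁽¹⁾ = −(2κ²/(d−1)) [A/(2d−1) − B/(4d−2) − C/(4d)]` (`nloFlowAction`), on the product of unit
spheres and for couplings with no self-coupling and adjoint pairs:
`−Σ_k ∂̃²_k S̃⁽¹⁾ + Σ_k ⟪∂̃_k S, ∂̃_k S̃⁽⁰⁾⟫ = (2κ²/d) D` — a constant (`D = normSum`, configuration-
independent for isometric-or-zero couplings, `normSum_eq`): the expansion
`S̃_t = S̃⁽⁰⁾ + t S̃⁽¹⁾ + O(t²)` satisfies `(−Σ∂̃² + t Σ∂̃S·∂̃) S̃_t = S + Ċ_t + O(t²)`. -/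
theorem nlo_equation (hU0 : ∀ n, U n n = 0)
    (hUadj : ∀ m n (v w : E), ⟪U m n v, w⟫ = ⟪v, U n m w⟫) (hd : 2 ≤ Module.finrank ℝ E)
    (κ S₀ : ℝ) {x : Λ → E} (hx : ∀ n, ‖x n‖ = 1) :
    -∑ k, siteLaplacian k (nloFlowAction κ U) x +
        ∑ k, ⟪siteGrad k (esAction κ S₀ U) x, siteGrad k (loFlowAction κ S₀ U) x⟫ =
      (2 * κ ^ 2 / (Module.finrank ℝ E : ℝ)) * normSum U x := by
  have hd' : (2 : ℝ) ≤ Module.finrank ℝ E := by exact_mod_cast hd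
  have h4 : (Module.finrank ℝ E : ℝ) ≠ 0 := by intro h; linarith
  have h5 : ((Module.finrank ℝ E : ℝ) - 1) ≠ 0 := by intro h; linarith
  have hx0 : ∀ k, x k ≠ 0 := fun k => ne_zero_of_norm_ne_zero (by rw [hx k]; exact one_ne_zero)
  obtain ⟨hA, hB, hC⟩ := contDiff_sums U
  have hW : ContDiff ℝ 2 (nloPotential U) := by
    unfold nloPotential
    exact ((contDiff_const.mul hA).sub (contDiff_const.mul hB)).sub (contDiff_const.mul hC)
  have hk : ∀ k, siteLaplacian k (nloFlowAction κ U) x =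
      -(2 * κ ^ 2 / ((Module.finrank ℝ E : ℝ) - 1)) * siteLaplacian k (nloPotential U) x :=
    fun k => siteLaplacian_const_mul (hx0 k) (contDiff_comp_update hW x k) _
  simp_rw [hk]
  rw [← Finset.mul_sum, sum_inner_siteGrad_esAction_loFlowAction hU0 hUadj hd κ S₀ hx,
    sum_siteLaplacian_nloPotential hU0 hUadj hd hx, sum_norm_tangentKick_sq U hx]
  field_simp
  ring

end NLO

end Summit.Ventures.LatticeQCDFlow.Exactness

end
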